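import Summits.HubbardSuperconductivity.HubbardSuperconductivity.Theorems.AnisotropyChordTransferFibre3FinXDCellTables
import Summits.HubbardSuperconductivity.HubbardSuperconductivity.Theorems.AnisotropyChordTransferFibre3FinXDYfun
import Summits.HubbardSuperconductivity.HubbardSuperconductivity.Theorems.AnisotropyChordTransferFibre3FinXBCert
import Summits.HubbardSuperconductivity.HubbardSuperconductivity.Theorems.AnisotropyChordTransferFibre3RowDPhase

/-!
# Route `AnisotropyChord` / H0 rotor rung: FIN per-`L` row-D evaluator XD — soundness layer 2a: scalars, phases, `Π̂`, `Y_e`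

Soundness of the per-momentum pieces of `…Fibre3FinXDEval` on a checked cell (hypotheses `XDHyp`, `…FinXDCellTables`), for EVERY
ground two-magnon profile whose `λ₂` lies in the cell: complex fixed-point intervals (`cmem`, `cmem_cadd/cmul/cscal/cconj`), the
scalars of `xdCell` (`a, c_s, f_nn = a + Vλ/4, A = V + a, S₁ = Σg = V·G̃(0), G̃(x̂), ε₁, T⁺ − 3λ₂ = ⟨Π⁰,C0⟩/‖Π⁰‖²` from g5's
`xbEval` objects), the per-momentum `g(q)`, `B(q)`, `δ(q)`, `ε(q)`, the phases `e^{imθ}` at integer `m` (`expI`, `phN`, `wf`), and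
★ `mem_piHat` (`Π̂(q₂,q₃)` is real and enclosed, `piHat_expansion_ground`), ★ `cmem_Y` (`Y_e(q)` enclosed, `yfun_oneloop` + the
direction reductions).  Prover seat `hubbard-h0-rotor-p3` g7; helper for piece A = stmt-HubbardSuperconductivity-23918 of rung 19089
(`--supports`, helper class).  WHAT THIS IS NOT: nothing here proves superconductivity in the Hubbard model (rotor TARGET as worded stays
FALSE, g15 verdict); evaluator soundness for the FIN certificates of ONE conditional reduction.  Tree imports only; no sorry, no new axioms.
-/

set_option linter.dupNamespace false
set_option autoImplicit false

namespace Summit.HubbardSuperconductivity.HubbardSuperconductivity.Theorems.AnisotropyChord.Transfer.Fibre3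

namespace FinXD

open scoped BigOperators
open Finset Hole2 FinCell FinXB RowD L2.N1

/-! ## Complex fixed-point intervals -/

/-- `z ∈ Z` componentwise. -/
def cmem (z : ℂ) (Z : CIv) : Prop := mem z.re Z.1 ∧ mem z.im Z.2

/-- sum. [folklore] -/
theorem cmem_cadd {x y : ℂ} {X Y : CIv} (hx : cmem x X) (hy : cmem y Y) : cmem (x + y) (cadd X Y) := by
  unfold cmem cadd
  rw [Complex.add_re, Complex.add_im]
  exact ⟨mem_iadd hx.1 hy.1, mem_iadd hx.2 hy.2⟩

/-- product. [folklore] -/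
theorem cmem_cmul {x y : ℂ} {X Y : CIv} (hx : cmem x X) (hy : cmem y Y) : cmem (x * y) (cmul X Y) := by
  unfold cmem cmul
  rw [Complex.mul_re, Complex.mul_im]
  exact ⟨mem_isub (mem_imul hx.1 hy.1) (mem_imul hx.2 hy.2), mem_iadd (mem_imul hx.1 hy.2) (mem_imul hx.2 hy.1)⟩

/-- real scaling. [folklore] -/
theorem cmem_cscal {r : ℝ} {z : ℂ} {R : Iv} {Z : CIv} (hr : mem r R) (hz : cmem z Z) : cmem ((r : ℂ) * z) (cscal R Z) := by
  unfold cmem cscal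
  rw [Complex.re_ofReal_mul, Complex.im_ofReal_mul]
  exact ⟨mem_imul hr hz.1, mem_imul hr hz.2⟩

/-- conjugate. [folklore] -/
theorem cmem_cconj {z : ℂ} {Z : CIv} (hz : cmem z Z) : cmem ((starRingEnd ℂ) z) (cconj Z) := by
  unfold cmem cconj
  rw [Complex.conj_re, Complex.conj_im]
  exact ⟨hz.1, mem_ineg hz.2⟩

/-- a real number as a complex one. [folklore] -/
theorem cmem_cre {r : ℝ} {R : Iv} (hr : mem r R) : cmem (r : ℂ) (cre R) := by
  unfold cmem cre
  rw [Complex.ofReal_re, Complex.ofReal_im]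
  exact ⟨hr, mem_zero⟩

/-- zero. [folklore] -/
theorem cmem_czero : cmem 0 czero := by
  unfold cmem czero
  rw [Complex.zero_re, Complex.zero_im]
  exact ⟨mem_zero, mem_zero⟩

/-- `1 ∈ cre ione`. [folklore] -/
theorem cmem_one : cmem 1 (cre ione) := by
  have h := cmem_cre mem_one
  simpa using h

/-! ## Integer momenta and directions -/

variable (L : ℕ) [NeZero L]

/-- the integer direction vectors `x̂, −x̂, ŷ, −ŷ`. -/
def dirInt (j : ℕ) : ℤ × ℤ := if j = 0 then (1, 0) else if j = 1 then (-1, 0) else if j = 2 then (0, 1) else (0, -1)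

/-- `eDir j = toTor (dirInt j)`. [folklore] -/
theorem eDir_eq_toTor (j : ℕ) : eDir L j = B1.toTor L (dirInt j) := by
  unfold eDir dirInt B1.toTor ex ey
  split_ifs <;> (ext <;> simp)

/-- `q · dirInt j = dotE j q`. [folklore] -/
theorem qdot_dirInt (j : ℕ) (q : ℤ × ℤ) : qdot q (dirInt j) = XDCell.dotE j q := by
  unfold qdot dirInt XDCell.dotE
  split_ifs <;> simp

/-- `−eDir j = eDir (jn j)` with the index swap `0 ↔ 1`, `2 ↔ 3`. [folklore] -/
theorem eDir_neg {j : ℕ} (hj : j < 4) :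
    -eDir L j = eDir L (if j = 0 then 1 else if j = 1 then 0 else if j = 2 then 3 else 2) := by
  unfold eDir
  interval_cases j <;> simp

/-- the natural pair of an integer momentum is its torus point. [folklore] -/
theorem natPair_modNat (q : ℤ × ℤ) :
    ((((modNat L q.1 : ℕ) : ZMod L), ((modNat L q.2 : ℕ) : ZMod L)) : Tor L) = B1.toTor L q := by
  have hL : 0 < L := Nat.pos_of_ne_zero (NeZero.ne L)
  unfold B1.toTor
  ext <;> simp [modNat_cast L hL]

/-- `isZ q ↔ toTor q = 0`. [folklore] -/
theorem isZ_iff (C : XDCell) (hC : C.L = L) (q : ℤ × ℤ) : C.isZ q = true ↔ B1.toTor L q = 0 := by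
  have hL : 0 < L := Nat.pos_of_ne_zero (NeZero.ne L)
  unfold XDCell.isZ
  rw [decide_eq_true_eq, hC, ← natPair_modNat L q, Prod.mk_eq_zero,
    natCast_zmod_eq_zero L (modNat_lt L hL _), natCast_zmod_eq_zero L (modNat_lt L hL _)]

/-- `cos(2πm/L)` at an integer `m` through its natural residue. [folklore] -/
theorem cos_int_modNat (m : ℤ) :
    Real.cos (2 * Real.pi / L * m) = Real.cos (2 * Real.pi * (modNat L m : ℕ) / L) ∧
    Real.sin (2 * Real.pi / L * m) = Real.sin (2 * Real.pi * (modNat L m : ℕ) / L) := by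
  have hL : 0 < L := Nat.pos_of_ne_zero (NeZero.ne L)
  have hLr : (L : ℝ) ≠ 0 := by exact_mod_cast (ne_of_gt hL)
  have hLz : (0 : ℤ) < L := by exact_mod_cast hL
  have hdiv : m = m % L + m / L * (L : ℤ) := (Int.emod_add_ediv_mul m L).symm
  have hnn : 0 ≤ m % L := Int.emod_nonneg _ (ne_of_gt hLz)
  have hcastZ : ((modNat L m : ℕ) : ℤ) = m % (L : ℤ) := by unfold modNat; exact Int.toNat_of_nonneg hnn
  have hcast : ((modNat L m : ℕ) : ℝ) = ((m % (L : ℤ) : ℤ) : ℝ) := by rw [← hcastZ]; simp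
  have e : 2 * Real.pi / L * (m : ℝ) = 2 * Real.pi * (modNat L m : ℕ) / L + ((m / (L : ℤ) : ℤ) : ℝ) * (2 * Real.pi) := by
    rw [hcast]
    conv_lhs => rw [hdiv]
    push_cast
    field_simp
  rw [e, Real.cos_add_int_mul_two_pi, Real.sin_add_int_mul_two_pi]
  exact ⟨rfl, rfl⟩

/-- ★ `e^{imθ} ∈ C.expI m` for every integer `m`. [folklore] -/
theorem cmem_expI (hL : 3 ≤ L) (C : XDCell) (hC : C.L = L) (hct : C.ct = cosTab L) (hct4 : C.ct4 = cosTab (4 * L)) (m : ℤ) :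
    cmem (Complex.exp (Complex.I * ((2 * Real.pi / L : ℝ) : ℂ) * ((m : ℤ) : ℂ))) (C.expI m) := by
  have hL0 : 0 < L := by omega
  have h4L : 3 ≤ 4 * L := by omega
  have h4L0 : 0 < 4 * L := by omega
  have hn : modNat L m < L := modNat_lt L hL0 m
  obtain ⟨hc, hs⟩ := cos_int_modNat L m
  have hexp : Complex.exp (Complex.I * ((2 * Real.pi / L : ℝ) : ℂ) * ((m : ℤ) : ℂ))
      = ((Real.cos (2 * Real.pi / L * m) : ℝ) : ℂ) + ((Real.sin (2 * Real.pi / L * m) : ℝ) : ℂ) * Complex.I := by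
    rw [show Complex.I * ((2 * Real.pi / L : ℝ) : ℂ) * ((m : ℤ) : ℂ) = ((2 * Real.pi / L * m : ℝ) : ℂ) * Complex.I by push_cast; ring,
      Complex.exp_mul_I, ← Complex.ofReal_cos, ← Complex.ofReal_sin]
  unfold cmem XDCell.expI
  rw [hexp, hC, hct, hct4]
  simp only [Complex.add_re, Complex.add_im, Complex.ofReal_re, Complex.ofReal_im, Complex.mul_re, Complex.mul_im,
    Complex.I_re, Complex.I_im, mul_zero, mul_one, sub_zero, zero_add, add_zero]
  rw [hc, hs]
  constructor
  · rw [getIv_cosTab hn]; exact mem_cosIv hL hn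
  · rw [sin_eq_cos_shift L hL0, cos_mod (4 * L) h4L0]
    have hidx : (4 * modNat L m + 3 * L) % (4 * L) < 4 * L := Nat.mod_lt _ h4L0
    rw [getIv_cosTab hidx]
    exact mem_cosIv h4L hidx

/-- ★ `e^{−iq·e_j} = conj (phase (toTor q) (eDir j)) ∈ C.phN j q`. [folklore] -/
theorem cmem_phN (hL : 3 ≤ L) (C : XDCell) (hC : C.L = L) (hct : C.ct = cosTab L) (hct4 : C.ct4 = cosTab (4 * L))
    (j : ℕ) (q : ℤ × ℤ) :
    cmem ((starRingEnd ℂ) (phase L (B1.toTor L q) (eDir L j))) (C.phN j q) := by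
  unfold XDCell.phN
  rw [eDir_eq_toTor, phase_toTor_E4, qdot_dirInt]
  exact cmem_cconj (cmem_expI L hL C hC hct hct4 _)

/-- ★ `1 + e^{iK₁·e_j} ∈ C.wf j`. [folklore] -/
theorem cmem_wf (hL : 3 ≤ L) (C : XDCell) (hC : C.L = L) (hct : C.ct = cosTab L) (hct4 : C.ct4 = cosTab (4 * L)) (j : ℕ) :
    cmem (1 + phase L (K1 L) (eDir L j)) (C.wf j) := by
  unfold XDCell.wf
  have hK : K1 L = B1.toTor L ((1 : ℤ), (0 : ℤ)) := by unfold K1 B1.toTor; ext <;> simp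
  rw [hK, eDir_eq_toTor, phase_toTor_E4, qdot_dirInt]
  exact cmem_cadd cmem_one (cmem_expI L hL C hC hct hct4 _)

/-! ## The scalars and the per-momentum values of `xdCell` -/

section cellPieces

variable {L} {Δ lam2 : ℝ} {f : Tor L → ℝ} {la lb : ℤ}

/-- the XD cell of the hypotheses. -/
def xdC (L : ℕ) (la lb : ℤ) : XDCell := xdCell L la lb (xdPoint L la) (xdPoint L lb)

omit [NeZero L] in
/-- the bookkeeping fields of the cell. [folklore] -/
theorem xdC_fields (L : ℕ) (la lb : ℤ) :
    (xdC L la lb).L = L ∧ (xdC L la lb).ct = cosTab L ∧ (xdC L la lb).ct4 = cosTab (4 * L) ∧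
    (xdC L la lb).gt = gresCellTab L (cosTab L) la lb ∧ (xdC L la lb).lam = (la, lb) := by
  unfold xdC xdCell
  exact ⟨rfl, rfl, rfl, rfl, rfl⟩

variable (H : XDHyp (L := L) Δ lam2 f la lb)
include H

omit H in
/-- `Σ_p g(p) = V·G̃(0)`. [folklore] -/
theorem sum_gres_eq (lam : ℝ) : (∑ p : Tor L, gres L lam p) = (L : ℝ) ^ 2 * Gres L lam 0 := by
  have hV : ((L : ℝ) ^ 2) ≠ 0 := pow_ne_zero 2 (Nat.cast_ne_zero.mpr (NeZero.ne L))
  unfold Gres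
  rw [mul_div_cancel₀ _ hV]
  refine Finset.sum_congr rfl fun p _ => ?_
  rw [phase_zero, Complex.one_re, mul_one]

/-- ★ the scalar enclosures: `λ₂, a, c_s, f_nn, A, S₁, ε₁`. [folklore] -/
theorem mem_scalars :
    mem lam2 (xdC L la lb).lam ∧ mem (Δ * f (K1 L)) (xdC L la lb).a ∧ mem (cS L Δ lam2 f) (xdC L la lb).cs ∧
    mem (f (K1 L)) (xdC L la lb).fnn ∧ mem ((L : ℝ) ^ 2 + Δ * f (K1 L)) (xdC L la lb).A ∧
    mem (∑ p : Tor L, gres L lam2 p) (xdC L la lb).S1 ∧ mem (eps1 L) (xdC L la lb).eps1 := by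
  have hS := H.cellHyp.hS
  obtain ⟨mlam, mcs, ma, -, -, -, -, -, -, -, meps⟩ := hS
  have hV4 : (0 : ℤ) < 4 := by norm_num
  -- `f_nn = a + Vλ/4`
  have hfnn : f (K1 L) = Δ * f (K1 L) + ((L * L : ℕ) : ℝ) * lam2 / 4 := by
    have h := lam2_sum_rule L H.cellHyp.hL3 H.hf.1
    push_cast
    nlinarith [h]
  unfold xdC xdCell
  simp only
  refine ⟨⟨H.hla, H.hlb⟩, ma, mcs, ?_, ?_, ?_, meps⟩
  · rw [hfnn]
    exact mem_iadd ma (mem_idivn (mem_iscale (L * L) ⟨H.hla, H.hlb⟩) hV4)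
  · have h := mem_iadd (mem_iconst ((L * L : ℕ) : ℤ)) ma
    push_cast at h ⊢
    have e : ((L : ℝ) ^ 2) = (L : ℝ) * L := sq _
    rw [e]; exact h
  · rw [sum_gres_eq]
    have h := mem_iscale (L * L) (mem_G0_cell L H.cellHyp.hL3 H.hla H.hlb H.cellHyp.hpos)
    push_cast at h
    have e : ((L : ℝ) ^ 2) = (L : ℝ) * L := sq _
    rw [e]; exact h

/-- ★ `T⁺ − 3λ₂ ∈ C.nt` (`= ⟨Π⁰,C0⟩/‖Π⁰‖²`, g5's object brackets). [folklore] -/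
theorem mem_nt (hP : 0 < (xbEval L la lb).2.P.1) : mem (Tplus L Δ f - 3 * lam2) (xdC L la lb).nt := by
  have hc := H.cellHyp
  have mP := hc.mem_objP
  have mQ := hc.mem_objQ
  have hD := D_pos
  have hPpos : 0 < PiNormSq L f := by
    have h1 : (0 : ℝ) < ((xbEval L la lb).2.P.1 : ℝ) := by exact_mod_cast hP
    have h2 := mP.1
    nlinarith
  have hid := sum_piR_C0fn L H.hf.1
  have e : Tplus L Δ f - 3 * lam2 = (∑ c : Cfg L, piR L f c * C0fn L Δ lam2 f c) * (1 / PiNormSq L f) := by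
    rw [hid]; field_simp
  unfold xdC xdCell
  simp only
  rw [e]
  exact mem_imul mQ (mem_iinv mP hP)

/-- ★ `G̃(x̂) ∈ C.gx` (point value at `λ₀ = la/D` plus `[0,h]·`slope, g4's `Gres_sub_Gres`). [folklore] -/
theorem mem_gx : mem (Gres L lam2 (ex L)) (xdC L la lb).gx := by
  have hL9 := H.hL
  have hL0 : 0 < L := by omega
  have hD := D_pos
  obtain ⟨h0a, h0b, h0c, h0le⟩ := H.lam0_mem
  set lam0 : ℝ := (la : ℝ) / ((D : ℤ) : ℝ) with hlam0
  have hex : ex L = ((((1 : ℕ) : ZMod L)), (((0 : ℕ) : ZMod L))) := by unfold ex; simp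
  have hpt := mem_Gres_cell L H.cellHyp.hL3 h0a h0c H.hpos0 (show 1 < L by omega) hL0
  have hne : ∀ k1 k2 : ℕ, k1 < L → k2 < L → ¬ (k1 = 0 ∧ k2 = 0) →
      2 * epsN L k1 k2 - lam2 ≠ 0 ∧ 2 * epsN L k1 k2 - lam0 ≠ 0 := fun k1 k2 hk1 hk2 hk =>
    ⟨ne_of_gt (den_ne_zero_of_cell L H.cellHyp.hL3 H.hla H.hlb H.cellHyp.hpos hk1 hk2 hk),
     ne_of_gt (den_ne_zero_of_cell L H.cellHyp.hL3 h0a h0b H.cellHyp.hpos hk1 hk2 hk)⟩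
  have hdiff := Gres_sub_Gres L hne (show 1 < L by omega) hL0
  have hslope := mem_GresSlope_cell L H.cellHyp.hL3 H.hla H.hlb h0a h0b H.cellHyp.hpos 1 0
  have hδ : mem (lam2 - lam0) (((0 : ℤ), lb - la) : Iv) := by
    unfold mem
    push_cast
    constructor
    · nlinarith
    · have : lam0 * ((D : ℤ) : ℝ) = la := div_mul_cancel₀ _ (ne_of_gt hD)
      nlinarith [H.hlb]
  have e : Gres L lam2 (ex L) = Gres L lam0 (ex L) + (lam2 - lam0) * slopeSum L lam2 lam0 1 0 := by
    rw [hex]; linarith [hdiff]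
  unfold xdC xdCell
  simp only
  rw [e, hex]
  exact mem_iadd hpt (mem_imul hδ hslope)

/-- ★ `g(q) ∈ C.g q`. [folklore] -/
theorem mem_g (q : ℤ × ℤ) : mem (gres L lam2 (B1.toTor L q)) ((xdC L la lb).g q) := by
  have hL0 : 0 < L := by have := H.hL; omega
  unfold xdC xdCell XDCell.g
  simp only
  rw [← natPair_modNat L q]
  exact mem_gAt L H.cellHyp.hL3 H.hla H.hlb H.cellHyp.hpos (modNat_lt L hL0 _) (modNat_lt L hL0 _)

/-- ★ `B(q) ∈ C.B q`. [folklore] -/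
theorem mem_B (q : ℤ × ℤ) : mem (Bhat L Δ lam2 f (B1.toTor L q)) ((xdC L la lb).B q) := by
  obtain ⟨-, ma, mcs, -⟩ := mem_scalars H
  have hz := isZ_iff L (xdC L la lb) (xdC_fields L la lb).1 q
  unfold XDCell.B
  by_cases h : (xdC L la lb).isZ q = true
  · rw [if_pos h]
    have h0 : B1.toTor L q = 0 := hz.mp h
    unfold Bhat; rw [h0]; unfold gres; simp only [if_true, mul_zero, sub_zero]
    exact mem_ineg ma
  · rw [if_neg h]
    unfold Bhat
    have e : -(Δ * f (K1 L)) - cS L Δ lam2 f * gres L lam2 (B1.toTor L q)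
        = -(Δ * f (K1 L) + cS L Δ lam2 f * gres L lam2 (B1.toTor L q)) := by ring
    rw [e]
    exact mem_ineg (mem_iadd ma (mem_imul mcs (mem_g H q)))

omit H in
/-- ★ `[q = 0] ∈ C.dl q`. [folklore] -/
theorem mem_dl (q : ℤ × ℤ) : mem (if B1.toTor L q = 0 then (1 : ℝ) else 0) ((xdC L la lb).dl q) := by
  have hz := isZ_iff L (xdC L la lb) (xdC_fields L la lb).1 q
  unfold XDCell.dl
  by_cases h : (xdC L la lb).isZ q = true
  · rw [if_pos h, if_pos (hz.mp h)]; exact mem_one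
  · rw [if_neg h, if_neg (fun h0 => h (hz.mpr h0))]; exact mem_zero

/-- ★ `ε(q) ∈ C.eps q`. [folklore] -/
theorem mem_eps (q : ℤ × ℤ) : mem (epsT L (B1.toTor L q)) ((xdC L la lb).eps q) := by
  have hL0 : 0 < L := by have := H.hL; omega
  have h1 := modNat_lt L hL0 q.1
  have h2 := modNat_lt L hL0 q.2
  unfold xdC xdCell XDCell.eps
  simp only
  rw [← natPair_modNat L q, epsT_natCast L h1 h2]
  unfold epsIv
  rw [getIv_cosTab h1, getIv_cosTab h2]
  have h2c : mem (2 : ℝ) ((2 * D - 0, 2 * D - 0) : Iv) := by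
    have := mem_iconst 2
    unfold iconst at this
    simpa [mul_comm] using this
  exact mem_isub (mem_isub h2c (mem_cosIv H.cellHyp.hL3 h1)) (mem_cosIv H.cellHyp.hL3 h2)

end cellPieces

end FinXD

end Summit.HubbardSuperconductivity.HubbardSuperconductivity.Theorems.AnisotropyChord.Transfer.Fibre3
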